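import Summits.ValiantsHypothesis.ValiantsHypothesis.Theorems.NewtonUnitEquationsTwoProductsTowerRecordWalk
import Summits.ValiantsHypothesis.ValiantsHypothesis.Theorems.NewtonUnitEquationsTwoProductsTowerRecordEnvelope

/-!
# R13∞-coeff — THE SWEEP OVER ALL WEIGHTS: `VertexWalkBound` and the LEVEL-FREE RECORD LAW, PROVED (val-idea-37 g4 rev 5 §12, part 3/3)

(8c) `wt_add_smul`/`score_add_smul` (affine scores along `ν + θ•ζ`, `ζ ⊥ d`), `Tset`/`OptT` (optimal pairs = `IsOpt`), `OptT_smul`, `OptT_line`,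
`F3_line` (= `psi_chain`), `letters_subset_of_isOpt` (= `cramerRecordLemma`), `exists_max_minor` (`r ≤ 2m`), `exists_frame` (`ν = d`, `ζ = d^⊥`; `d = 0`:
`e₀, e₁`), `arith_walk`, ★★ `vertexWalkBound_holds : VertexWalkBound` (`≤ 2(r(n−1)+1)+3 ≤ 4mn+4` letter sets), ★★ `levelFreeRecordLaw_holds :
LevelFreeRecordLaw` (`(a,b) = (11,1)`: ARBITRARY pencils, bound free of the height, the level set, any dissociation or sign hypothesis — crit-8's Q-R13
answered YES on the coefficient side, in the kernel).
Transplant (val-lit-p3 g18) of val-idea-37 g4's kernel-checked scratch `Cruxes/TwoProducts/TowerRecords_val_idea_37_g4.lean` (rev 5 §12,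
sha16 bf5159e121ff5e9d (§1–§11 = rev 4 2a92eb1f7d59f466); val-idea-crit-8 g2 VERDICT #20 by-name check, ns `ValIdea37g4T`; val-idea-crit-8 g2 VERDICT #19 + addendum: KEEP «R13-coeff», by-name GO for a verbatim transplant);
proofs verbatim by name, docstrings added, namespace = the tree's.  Helper on crux `stmt-ValiantsHypothesis-5906` (`TwoProducts`, line
`relation_ladder`); `--supports`, closes nothing by itself.  HONEST LABEL (crit-8 #19): COEFFICIENT-SIDE; the class rung it feeds (R13, dense
parallel towers on dissociated carriers) is a wider CLASS rung, inert as a hatch; F10's collinear digit towers NOT covered; `ResidualLawV24` ⟺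
`PlanarCellBound`, the crux (stmt-5906), every `closes` binder and every summit statement UNMOVED; VP ≠ VNP is NOT proved.
Credit: mathematics and kernel proofs val-idea-37 g4; critic of record val-idea-crit-8 g2.  No instances, no notation, no named facts. [folklore]
-/

set_option linter.dupNamespace false

noncomputable section

open Classical

namespace Summit.ValiantsHypothesis.ValiantsHypothesis.Theorems.NewtonUnitEquations.TwoProducts.TowerRecord

open scoped BigOperators
open Module Polynomial
open Summit.ValiantsHypothesis.ValiantsHypothesis.Theorems.NewtonUnitEquations.TwoProducts.FormalLogLinearisation
open Summit.ValiantsHypothesis.ValiantsHypothesis.Theorems.NewtonUnitEquations.TwoProducts.MomentRecord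
open Summit.ValiantsHypothesis.ValiantsHypothesis.Theorems.NewtonUnitEquations.TwoProducts.PlanarCell

variable {m n : ℕ}

/-! ### Assembly: the sweep over all weights -/

section Sweep

/-- `wt (ν + θ•ζ) e = wt ν e + θ·wt ζ e`. [folklore] -/
theorem wt_add_smul (ν ζ : Fin 2 → ℝ) (θ : ℝ) (e : Expo) : wt (ν + θ • ζ) e = wt ν e + θ * wt ζ e := by
  simp only [wt, Pi.add_apply, Pi.smul_apply, smul_eq_mul]
  ring

/-- `wtZ (ν + θ•ζ) d = wtZ ν d + θ·wtZ ζ d`. [folklore] -/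
theorem wtZ_add_smul (ν ζ : Fin 2 → ℝ) (θ : ℝ) (d : Fin 2 → ℤ) : wtZ (ν + θ • ζ) d = wtZ ν d + θ * wtZ ζ d := by
  simp only [wtZ, Pi.add_apply, Pi.smul_apply, smul_eq_mul]
  ring

/-- `wt (t•ξ) e = t·wt ξ e`. [folklore] -/
theorem wt_smul (t : ℝ) (ξ : Fin 2 → ℝ) (e : Expo) : wt (t • ξ) e = t * wt ξ e := by
  simp only [wt, Pi.smul_apply, smul_eq_mul]
  ring

/-- `wtZ (t•ξ) d = t·wtZ ξ d`. [folklore] -/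
theorem wtZ_smul (t : ℝ) (ξ : Fin 2 → ℝ) (d : Fin 2 → ℤ) : wtZ (t • ξ) d = t * wtZ ξ d := by
  simp only [wtZ, Pi.smul_apply, smul_eq_mul]
  ring

/-- Along a line `ν + θ•ζ` with `ζ ⊥ d` the score is affine in `θ` with slope `wsum ζ`. [folklore] -/
theorem score_add_smul (x : Fin n → Expo) (d : Fin 2 → ℤ) (ν ζ : Fin 2 → ℝ) (θ : ℝ) (hζ : wtZ ζ d = 0) {r : ℕ}
    (β : Fin r → Fin n) (s : ℕ) : score (ν + θ • ζ) x d β s = score ν x d β s + θ * wsum ζ x β := by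
  simp only [score, wsum, wt_add_smul, wtZ_add_smul, hζ, Finset.sum_add_distrib, Finset.mul_sum]
  ring

/-- The score is homogeneous in the weight. [folklore] -/
theorem score_smul (x : Fin n → Expo) (d : Fin 2 → ℤ) (t : ℝ) (ξ : Fin 2 → ℝ) {r : ℕ} (β : Fin r → Fin n) (s : ℕ) :
    score (t • ξ) x d β s = t * score ξ x d β s := by
  simp only [score, wsum, wt_smul, wtZ_smul, mul_add, Finset.mul_sum]
  ring

variable (γ γ' : Fin m → Fin n → ℂ[X]) (x : Fin n → Expo) (d : Fin 2 → ℤ)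

/-- All pairs `(β, s)` with `[z^s] minor(ρ, β) ≠ 0`. -/
def Tset {r : ℕ} (ρ : Fin r → Fin m ⊕ Fin m) : Finset ((Fin r → Fin n) × ℕ) :=
  (Finset.univ : Finset (Fin r → Fin n)).biUnion fun β => ((minorT γ γ' ρ β).support).image fun s => (β, s)

/-- Membership in the finite set of pairs `(β, s)` with `s` in the support of the minor. [folklore] -/
theorem mem_Tset {r : ℕ} {ρ : Fin r → Fin m ⊕ Fin m} {p : (Fin r → Fin n) × ℕ} :
    p ∈ Tset γ γ' ρ ↔ (minorT γ γ' ρ p.1).coeff p.2 ≠ 0 := by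
  rcases p with ⟨β, s⟩
  simp only [Tset, Finset.mem_biUnion, Finset.mem_univ, true_and, Finset.mem_image, Prod.mk.injEq]
  constructor
  · rintro ⟨β', s', hs', rfl, rfl⟩
    exact Polynomial.mem_support_iff.mp hs'
  · intro h
    exact ⟨β, s, Polynomial.mem_support_iff.mpr h, rfl, rfl⟩

/-- The `ξ`-optimal pairs. -/
def OptT (ξ : Fin 2 → ℝ) {r : ℕ} (ρ : Fin r → Fin m ⊕ Fin m) : Finset ((Fin r → Fin n) × ℕ) :=
  (Tset γ γ' ρ).filter fun p => ∀ q ∈ Tset γ γ' ρ, score ξ x d q.1 q.2 ≤ score ξ x d p.1 p.2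

/-- Membership in the optimal pairs at `ξ` = `IsOpt`. [folklore] -/
theorem mem_OptT {ξ : Fin 2 → ℝ} {r : ℕ} {ρ : Fin r → Fin m ⊕ Fin m} {p : (Fin r → Fin n) × ℕ} :
    p ∈ OptT γ γ' x d ξ ρ ↔ IsOpt γ γ' x d ξ ρ p.1 p.2 := by
  simp only [OptT, Finset.mem_filter, mem_Tset, IsOpt]
  constructor
  · rintro ⟨h1, h2⟩
    exact ⟨h1, fun β' s' hs' => h2 (β', s') hs'⟩
  · rintro ⟨h1, h2⟩
    exact ⟨h1, fun q hq => h2 q.1 q.2 hq⟩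

/-- Optimal pairs exist when `Tset` is nonempty. [folklore] -/
theorem OptT_nonempty {r : ℕ} {ρ : Fin r → Fin m ⊕ Fin m} (hT : (Tset γ γ' ρ).Nonempty) (ξ : Fin 2 → ℝ) :
    (OptT γ γ' x d ξ ρ).Nonempty := by
  obtain ⟨p, hp, hmax⟩ := Finset.exists_max_image _ (fun q : (Fin r → Fin n) × ℕ => score ξ x d q.1 q.2) hT
  exact ⟨p, Finset.mem_filter.mpr ⟨hp, hmax⟩⟩

/-- Optimal pairs are invariant under positive scaling of the weight. [folklore] -/
theorem OptT_smul {t : ℝ} (ht : 0 < t) (ξ : Fin 2 → ℝ) {r : ℕ} (ρ : Fin r → Fin m ⊕ Fin m) :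
    OptT γ γ' x d (t • ξ) ρ = OptT γ γ' x d ξ ρ := by
  unfold OptT
  refine Finset.filter_congr fun p hp => ?_
  simp only [score_smul]
  refine forall₂_congr fun q hq => ⟨fun h => le_of_mul_le_mul_left h ht, fun h => mul_le_mul_of_nonneg_left h ht.le⟩

/-- On the line `ν + θ•ζ` (`ζ ⊥ d`) the optimal pairs are the abstract optimal set `OptA θ`. [folklore] -/
theorem OptT_line (ν ζ : Fin 2 → ℝ) (hζ : wtZ ζ d = 0) (θ : ℝ) {r : ℕ} (ρ : Fin r → Fin m ⊕ Fin m) :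
    OptT γ γ' x d (ν + θ • ζ) ρ
      = OptA (Tset γ γ' ρ) (fun p => score ν x d p.1 p.2) (fun p => wsum ζ x p.1) θ := by
  unfold OptT OptA
  refine Finset.filter_congr fun p hp => ?_
  simp only [score_add_smul x d ν ζ θ hζ]

/-- (F3) on a line: inside `Opt(ν + θζ)` the rank potential rises strictly towards the right vertex (`psi_chain`). -/
theorem F3_line (ν ζ : Fin 2 → ℝ) (hζ : wtZ ζ d = 0) {r : ℕ} (ρ : Fin r → Fin m ⊕ Fin m) :
    ∀ θ : ℝ, ∀ p ∈ OptA (Tset γ γ' ρ) (fun p => score ν x d p.1 p.2) (fun p => wsum ζ x p.1) θ,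
      ∀ q ∈ RVA (Tset γ γ' ρ) (fun p => score ν x d p.1 p.2) (fun p => wsum ζ x p.1) θ,
        wsum ζ x p.1 < wsum ζ x q.1 → Psi ζ x p.1 < Psi ζ x q.1 := by
  intro θ p hp q hq hσ
  have hqO : q ∈ OptT γ γ' x d (ν + θ • ζ) ρ := by
    rw [OptT_line γ γ' x d ν ζ hζ θ ρ]
    exact (mem_RVA.mp hq).1
  have hp' : p ∈ OptT γ γ' x d (ν + θ • ζ) ρ := by
    rw [OptT_line γ γ' x d ν ζ hζ θ ρ]
    exact hp
  have hqI : IsOpt γ γ' x d (ν + θ • ζ) ρ q.1 q.2 := (mem_OptT γ γ' x d).mp hqO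
  have hpI : IsOpt γ γ' x d (ν + θ • ζ) ρ p.1 p.2 := (mem_OptT γ γ' x d).mp hp'
  have hlam : ∀ (β' : Fin r → Fin n) (s' : ℕ), IsOpt γ γ' x d (ν + θ • ζ) ρ β' s' → wsum ζ x β' ≤ wsum ζ x q.1 := by
    intro β' s' h'
    have hmem : (β', s') ∈ OptT γ γ' x d (ν + θ • ζ) ρ := (mem_OptT γ γ' x d).mpr h'
    rw [OptT_line γ γ' x d ν ζ hζ θ ρ] at hmem
    exact (mem_RVA.mp hq).2 (β', s') hmem
  have key := psi_chain ζ hqI hlam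
    ((Finset.univ.filter fun u => p.1 u ∉ Finset.univ.image q.1).card) p.1 p.2 hpI rfl
  exact key.2 hσ

/-- Cramer cover: the record letters at `ξ` are columns of ANY `ξ`-optimal selection. -/
theorem letters_subset_of_isOpt {r : ℕ} {ρ : Fin r → Fin m ⊕ Fin m}
    (hmax : ∀ (ρ' : Fin (r + 1) → Fin m ⊕ Fin m) (β' : Fin (r + 1) → Fin n), minorT γ γ' ρ' β' = 0)
    {ξ : Fin 2 → ℝ} {β : Fin r → Fin n} {s : ℕ} (h : IsOpt γ γ' x d ξ ρ β s) (m' : ℕ) :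
    recordLettersAt γ γ' x d m' ξ ⊆ Finset.univ.image β := by
  intro a ha
  simp only [recordLettersAt, Finset.mem_filter, Finset.mem_univ, true_and] at ha
  obtain ⟨S, k, hrec, hSa⟩ := ha
  by_contra hna
  have ha' : ∀ q, β q ≠ a := fun q hq => hna (Finset.mem_image.mpr ⟨q, Finset.mem_univ _, hq⟩)
  have hopt' : ∀ β' : Fin r → Fin n, ∀ s' ∈ (minorT γ γ' ρ β').support,
      wsum ξ x β' + (s' : ℝ) * wtZ ξ d ≤ wsum ξ x β + (s : ℝ) * wtZ ξ d :=
    fun β' s' hs' => h.2 β' s' (Polynomial.mem_support_iff.mp hs')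
  exact cramerRecordLemma γ γ' x d m' ξ S k hrec ρ β s h.1 hmax hopt' a hSa ha'

/-- A maximal non-vanishing minor of the pencil matrix (`r ≤ 2m`). -/
theorem exists_max_minor : ∃ r : ℕ, r ≤ 2 * m ∧ ∃ (ρ : Fin r → Fin m ⊕ Fin m) (β₀ : Fin r → Fin n),
    minorT γ γ' ρ β₀ ≠ 0 ∧ ∀ (ρ' : Fin (r + 1) → Fin m ⊕ Fin m) (β' : Fin (r + 1) → Fin n), minorT γ γ' ρ' β' = 0 := by
  let P : ℕ → Prop := fun k => ∀ (ρ : Fin k → Fin m ⊕ Fin m) (β : Fin k → Fin n), minorT γ γ' ρ β = 0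
  have hP : P (2 * m + 1) := by
    intro ρ β
    obtain ⟨p, p', hne, heq⟩ := Fintype.exists_ne_map_eq_of_card_lt ρ (by simp; omega)
    exact Matrix.det_zero_of_row_eq hne (funext fun u => by simp [Matrix.of_apply, heq])
  have hex : ∃ k, P k := ⟨_, hP⟩
  have h0 : ¬ P 0 := by
    intro h
    have := h Fin.elim0 Fin.elim0
    rw [minorT, Matrix.det_fin_zero] at this
    exact one_ne_zero this
  obtain ⟨r, hr⟩ : ∃ r, Nat.find hex = r + 1 :=
    Nat.exists_eq_succ_of_ne_zero (fun h => h0 (h ▸ Nat.find_spec hex))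
  have hmax : P (r + 1) := hr ▸ Nat.find_spec hex
  have hr2 : r ≤ 2 * m := by
    have := Nat.find_le (h := hex) hP
    omega
  have hnot : ¬ P r := Nat.find_min hex (by omega)
  simp only [P, not_forall] at hnot
  obtain ⟨ρ, β₀, hβ₀⟩ := hnot
  exact ⟨r, hr2, ρ, β₀, hβ₀, hmax⟩

/-- An orthogonal frame adapted to `d`: `ζ ⊥ d`, and every weight decomposes as `a ν + b ζ`. -/
theorem exists_frame : ∃ ν ζ : Fin 2 → ℝ, wtZ ζ d = 0 ∧ ∀ ξ : Fin 2 → ℝ, ∃ a b : ℝ, ξ = a • ν + b • ζ := by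
  obtain ⟨d0, hd0⟩ : ∃ d0 : ℝ, d0 = ((d 0 : ℤ) : ℝ) := ⟨_, rfl⟩
  obtain ⟨d1, hd1⟩ : ∃ d1 : ℝ, d1 = ((d 1 : ℤ) : ℝ) := ⟨_, rfl⟩
  by_cases hd : d0 = 0 ∧ d1 = 0
  · refine ⟨![1, 0], ![0, 1], ?_, fun ξ => ⟨ξ 0, ξ 1, ?_⟩⟩
    · simp only [wtZ, ← hd0, ← hd1, hd.1, hd.2]
      simp
    · funext i
      fin_cases i <;> simp
  · have hD : 0 < d0 ^ 2 + d1 ^ 2 := by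
      rcases not_and_or.mp hd with h | h
      · have : 0 < d0 ^ 2 := by positivity
        nlinarith [sq_nonneg d1]
      · have : 0 < d1 ^ 2 := by positivity
        nlinarith [sq_nonneg d0]
    have hDne : d0 ^ 2 + d1 ^ 2 ≠ 0 := ne_of_gt hD
    refine ⟨![d0, d1], ![-d1, d0], ?_, fun ξ =>
      ⟨(ξ 0 * d0 + ξ 1 * d1) / (d0 ^ 2 + d1 ^ 2), (-(ξ 0) * d1 + ξ 1 * d0) / (d0 ^ 2 + d1 ^ 2), ?_⟩⟩
    · simp only [wtZ, ← hd0, ← hd1]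
      simp
      ring
    · funext i
      fin_cases i
      · simp
        field_simp
        ring
      · simp
        field_simp
        ring

/-- Arithmetic: `2(r(n−1)+1) + 3 ≤ 4mn + 4` for `m, n ≥ 1`, `r ≤ 2m`. [folklore] -/
theorem arith_walk {m n r : ℕ} (hm : 1 ≤ m) (hn : 1 ≤ n) (hr : r ≤ 2 * m) :
    (r * (n - 1) + 1) + (r * (n - 1) + 1) + 3 ≤ 4 * m * n + 4 := by
  obtain ⟨n', rfl⟩ : ∃ n', n = n' + 1 := ⟨n - 1, by omega⟩
  have h1 : r * (n' + 1 - 1) ≤ 2 * m * n' := by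
    rw [Nat.add_sub_cancel]
    exact Nat.mul_le_mul_right _ hr
  nlinarith

/-- **VERTEX WALK BOUND, PROVED**: `≤ 4mn + 4` sets of `≤ 2m` letters cover the record letters of every real weight. -/
theorem vertexWalkBound_holds : VertexWalkBound := by
  intro m n γ γ' x d
  -- degenerate sizes
  by_cases hmn : m = 0 ∨ n = 0
  · refine ⟨{∅}, by simp, by simp, fun ξ => ⟨∅, by simp, ?_⟩⟩
    rcases hmn with hm | hn
    · subst hm
      intro a ha
      simp only [recordLettersAt, Finset.mem_filter, Finset.mem_univ, true_and] at ha
      obtain ⟨S, k, hrec, -⟩ := ha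
      have h := hrec.1
      simp only [liveT, Set.mem_setOf_eq, layerT, momentPolyT] at h
      exact absurd (by simp) h.2
    · subst hn
      intro a _
      exact a.elim0
  have hm : 1 ≤ m := Nat.pos_of_ne_zero fun h => hmn (Or.inl h)
  have hn : 1 ≤ n := Nat.pos_of_ne_zero fun h => hmn (Or.inr h)
  -- a maximal minor, the pair set, the frame
  obtain ⟨r, hr, ρ, β₀, hβ₀, hmax⟩ := exists_max_minor γ γ'
  obtain ⟨ν, ζ, hζ, hframe⟩ := exists_frame d
  have hT : (Tset γ γ' ρ).Nonempty := by
    obtain ⟨s, hs⟩ := Finset.nonempty_iff_ne_empty.mpr (mt Polynomial.support_eq_empty.mp hβ₀)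
    exact ⟨(β₀, s), (mem_Tset γ γ').mpr (Polynomial.mem_support_iff.mp hs)⟩
  have hB : ∀ p ∈ Tset γ γ' ρ, (fun p : (Fin r → Fin n) × ℕ => Psi ζ x p.1) p ≤ r * (n - 1) :=
    fun p _ => Psi_le ζ x p.1
  -- the line families for `+ν + θζ` and `-ν + θζ`
  let rng : (Fin r → Fin n) × ℕ → Finset (Fin n) := fun p => Finset.univ.image p.1
  let Nof : Finset ((Fin r → Fin n) × ℕ) → Finset (Fin n) := fun R =>
    Finset.univ.filter fun a => ∀ p ∈ R, a ∈ rng p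
  obtain ⟨𝒩p, hcp, hmp, hep⟩ := exists_lineFamily (T := Tset γ γ' ρ) (α := fun p => score ν x d p.1 p.2)
    (σ := fun p => wsum ζ x p.1) (fun p => Psi ζ x p.1) (F3_line γ γ' x d ν ζ hζ ρ) hT hB Nof
  obtain ⟨𝒩m, hcm, hmm, hem⟩ := exists_lineFamily (T := Tset γ γ' ρ) (α := fun p => score (-ν) x d p.1 p.2)
    (σ := fun p => wsum ζ x p.1) (fun p => Psi ζ x p.1) (F3_line γ γ' x d (-ν) ζ hζ ρ) hT hB Nof
  -- fixed optimal selections for the directions `ζ`, `-ζ`, `0`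
  obtain ⟨pζ, hpζ⟩ := OptT_nonempty γ γ' x d hT ζ
  obtain ⟨pζ', hpζ'⟩ := OptT_nonempty γ γ' x d hT (-ζ)
  obtain ⟨p0, hp0⟩ := OptT_nonempty γ γ' x d hT 0
  have hrng : ∀ p : (Fin r → Fin n) × ℕ, (rng p).card ≤ 2 * m := fun p =>
    Finset.card_image_le.trans (by simp [hr])
  have hNof : ∀ (R : Finset ((Fin r → Fin n) × ℕ)), R.Nonempty → (Nof R).card ≤ 2 * m := by
    intro R ⟨p, hp⟩
    refine (Finset.card_le_card fun a ha => ?_).trans (hrng p)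
    exact (Finset.mem_filter.mp ha).2 p hp
  -- covering by an optimal selection
  have hcov : ∀ (ξ : Fin 2 → ℝ) (p : (Fin r → Fin n) × ℕ), p ∈ OptT γ γ' x d ξ ρ →
      recordLettersAt γ γ' x d m ξ ⊆ rng p := fun ξ p hp =>
    letters_subset_of_isOpt γ γ' x d hmax ((mem_OptT γ γ' x d).mp hp) m
  have hcovN : ∀ (ξ : Fin 2 → ℝ) (R : Finset ((Fin r → Fin n) × ℕ)), R ⊆ OptT γ γ' x d ξ ρ →
      recordLettersAt γ γ' x d m ξ ⊆ Nof R := by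
    intro ξ R hR a ha
    exact Finset.mem_filter.mpr ⟨Finset.mem_univ _, fun p hp => hcov ξ p (hR hp) ha⟩
  refine ⟨𝒩p ∪ 𝒩m ∪ {rng pζ, rng pζ', rng p0}, ?_, ?_, ?_⟩
  · -- count
    calc (𝒩p ∪ 𝒩m ∪ {rng pζ, rng pζ', rng p0}).card
        ≤ (𝒩p ∪ 𝒩m).card + ({rng pζ, rng pζ', rng p0} : Finset (Finset (Fin n))).card := Finset.card_union_le _ _
      _ ≤ (𝒩p.card + 𝒩m.card) + 3 := add_le_add (Finset.card_union_le _ _) Finset.card_le_three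
      _ ≤ (r * (n - 1) + 1) + (r * (n - 1) + 1) + 3 := by omega
      _ ≤ 4 * m * n + 4 := arith_walk hm hn hr
  · -- sizes
    intro N hN
    rcases Finset.mem_union.mp hN with hN | hN
    · rcases Finset.mem_union.mp hN with hN | hN
      · obtain ⟨θ, rfl⟩ := hep N hN
        exact hNof _ (RVA_nonempty hT θ)
      · obtain ⟨θ, rfl⟩ := hem N hN
        exact hNof _ (RVA_nonempty hT θ)
    · simp only [Finset.mem_insert, Finset.mem_singleton] at hN
      rcases hN with rfl | rfl | rfl <;> exact hrng _
  · -- cover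
    intro ξ
    obtain ⟨a, b, hab⟩ := hframe ξ
    rcases lt_trichotomy 0 a with ha | ha | ha
    · -- `a > 0`: the line `ν + θζ`, `θ = b / a`
      have hθ : ξ = a • (ν + (b / a) • ζ) := by
        have : a * (b / a) = b := by field_simp
        rw [hab, smul_add, smul_smul, this]
      refine ⟨Nof (RVA (Tset γ γ' ρ) (fun p => score ν x d p.1 p.2) (fun p => wsum ζ x p.1) (b / a)),
        Finset.mem_union_left _ (Finset.mem_union_left _ (hmp _)), hcovN ξ _ fun p hp => ?_⟩
      rw [hθ, OptT_smul γ γ' x d ha, OptT_line γ γ' x d ν ζ hζ]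
      exact (mem_RVA.mp hp).1
    · -- `a = 0`: `ξ = b ζ`
      rw [← ha, zero_smul, zero_add] at hab
      rcases lt_trichotomy 0 b with hb | hb | hb
      · refine ⟨rng pζ, by simp, hcov ξ pζ ?_⟩
        rw [hab, OptT_smul γ γ' x d hb]
        exact hpζ
      · refine ⟨rng p0, by simp, hcov ξ p0 ?_⟩
        rw [hab, ← hb, zero_smul]
        exact hp0
      · refine ⟨rng pζ', by simp, hcov ξ pζ' ?_⟩
        have hθ : ξ = (-b) • (-ζ) := by rw [hab, smul_neg, neg_smul, neg_neg]
        rw [hθ, OptT_smul γ γ' x d (neg_pos.mpr hb)]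
        exact hpζ'
    · -- `a < 0`: the line `-ν + θζ`, `θ = b / (-a)`
      have hθ : ξ = (-a) • (-ν + (b / (-a)) • ζ) := by
        have hane : a ≠ 0 := ha.ne
        have : (-a) * (b / (-a)) = b := by field_simp
        rw [hab, smul_add, smul_smul, this, smul_neg, neg_smul, neg_neg]
      refine ⟨Nof (RVA (Tset γ γ' ρ) (fun p => score (-ν) x d p.1 p.2) (fun p => wsum ζ x p.1) (b / (-a))),
        Finset.mem_union_left _ (Finset.mem_union_right _ (hmm _)), hcovN ξ _ fun p hp => ?_⟩
      rw [hθ, OptT_smul γ γ' x d (neg_pos.mpr ha), OptT_line γ γ' x d (-ν) ζ hζ]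
      exact (mem_RVA.mp hp).1

/-- **LEVEL-FREE RECORD LAW, PROVED** (`(a, b) = (11, 1)`): arbitrary pencils, arbitrary levels and heights. -/
theorem levelFreeRecordLaw_holds : LevelFreeRecordLaw := levelFree_of_vertexWalk vertexWalkBound_holds

end Sweep

end Summit.ValiantsHypothesis.ValiantsHypothesis.Theorems.NewtonUnitEquations.TwoProducts.TowerRecord

end
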